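import Mathlib
import HarnessLib
import Literature.MathematicalPhysics.QuantumFieldTheory.ConstructiveQFTWave0
import Literature.MathematicalPhysics.QuantumLattice.AbelianFieldTensor
import Literature.MathematicalPhysics.QuantumLattice.AbelianMagneticFlux
import Summits.Ventures.LatticeQCDFlow.Scaling.TopologicalCollar
import Summits.Ventures.LatticeQCDFlow.Scaling.FluxSectorCollar
import Summits.Ventures.LatticeQCDFlow.Scaling.SectorConfinement
import Summits.Ventures.LatticeQCDFlow.Scaling.CosineBudget

/-!
# LatticeQCDFlow / Scaling — TUNNELLING LAWS II(a): the `U(1)` flux sector — plane bookkeeping and the PATCH separating set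

HONEST FRAMING: exact (Metropolis-corrected) sampling algorithms for lattice gauge theory;
figures of merit are autocorrelation/cost numbers at stated couplings and volumes; no
continuum-physics claim.

THEORY-2.md §3.3 (v3.0, theory seat GEN-17).  `Scaling/TunnellingLaws.lean` proves the abstract TUNNELLING LAW
(stationary charge-change probability per step `≤ 2·μ(B)` for every set `B` separating the charge along the
allowed moves of a `μ`-invariant kernel).  This file supplies the PATCH separating set for the geometric `U(1)`
flux charge `Q = Φ_{μν}(x₀)/2π ∈ ℤ` of a `(μ,ν)`-plane of the periodic torus (`Scaling/FluxSectorCollar.lean`),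
compact `U(1) = Circle`, every `d`, every `L ≥ 1`, NO hypothesis on any measure:
LOCAL PATCHES (heat bath / Metropolis link and multi-link updates, domain-decomposed or masked flow proposals
— ANY update after which the plane plaquettes outside a finite set `P` of `m = #P` plane positions are
unchanged): if `Q(U) ≠ Q(U')` then `S_P(U)` or `S_P(U')` is `≥ 2/m` (chord constant,
`patchAction_ge_or_of_topCharge_ne`) and indeed `≥ m(1 - cos(π/m))` (SHARP, `patchAction_ge_sharp_or_of_topCharge_ne`,
via `Scaling/CosineBudget.lean`; `= 2` for `m ≤ 2`: a single-link update in `d = 2` must pass a configuration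
whose two plane plaquettes at the link have Wilson weight `≤ e^{-2β}` relative to their maximum), where
`S_P = Σ_{p∈P}(1 - Re u_p)` is the `β = 1` Wilson action of the patch.  Proof: `Φ - Φ' = Σ_{p∈P}(F_p - F'_p)` is a
non-zero multiple of `2π` and `|F_p - F'_p| ≤ |F_p| + |F'_p|`, so `Σ_P|F_p| ≥ π` for `U` or for `U'`
(`pi_le_sum_abs_or_of_topCharge_ne`); then `1 - Re u_p = ‖1 - u_p‖²/2 ≥ (2/π²)F_p²` and Cauchy–Schwarz (chord), or
`1 - Re u_p = 1 - cos F_p` and the cosine budget (sharp).  Links version: `plaquette_eq_off_patch_of_links` (an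
update of the links `Λ` leaves every plane plaquette not touching `Λ` unchanged).  The small-step separating set
is `Scaling/FluxSmallSteps.lean`; the laws are assembled in `Scaling/FluxTunnelling.lean`.
-/

noncomputable section

namespace Summit.Ventures.LatticeQCDFlow.Theory2.Lattice.Flux

open MeasureTheory ProbabilityTheory Metric Set Filter Topology Real
open scoped ENNReal
open Literature.MathematicalPhysics.QuantumFieldTheory Literature.MathematicalPhysics.QuantumLattice

variable {d L : ℕ}

/-! ## §1. Plane bookkeeping -/

/-- The site `x₀ + s·μ̂ + t·ν̂` of the `(μ,ν)`-plane through `x₀`, indexed by `p = (s,t)`. [folklore] -/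
def planeSite (x₀ : Site d L) (μ ν : Fin d) (p : ZMod L × ZMod L) : Site d L :=
  x₀ + Pi.single μ p.1 + Pi.single ν p.2

/-- The total chordal displacement of the four links of the `(μ,ν)`-plaquette at `x` between two
configurations. [folklore] -/
def plaqDisp (U U' : GaugeConfig d L Circle) (x : Site d L) (μ ν : Fin d) : ℝ :=
  dist (U (x, μ)) (U' (x, μ)) + dist (U (x.shift μ, ν)) (U' (x.shift μ, ν)) +
    dist (U (x.shift ν, μ)) (U' (x.shift ν, μ)) + dist (U (x, ν)) (U' (x, ν))

/-- The PLANE COLLAR of width `s`: some plaquette of the `(μ,ν)`-plane through `x₀` is within chordal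
distance `s` of `-1`.  (Contained in the all-plaquette `collar μ ν s` of `Scaling/FluxSectorCollar`.)
[folklore] -/
def planeCollar (x₀ : Site d L) (μ ν : Fin d) (s : ℝ) : Set (GaugeConfig d L Circle) :=
  {U | ∃ p : ZMod L × ZMod L, ‖((plaquetteHolonomy U (planeSite x₀ μ ν p) μ ν : Circle) : ℂ) + 1‖ ≤ s}

/-- The `β = 1` Wilson action `S_P(U) = Σ_{p ∈ P} (1 - Re u_p(U))` of the plane plaquettes indexed by
the patch `P`. [folklore] -/
def patchAction (x₀ : Site d L) (μ ν : Fin d) (P : Finset (ZMod L × ZMod L))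
    (U : GaugeConfig d L Circle) : ℝ :=
  ∑ p ∈ P, (1 - (((plaquetteHolonomy U (planeSite x₀ μ ν p) μ ν : Circle) : ℂ)).re)

/-- The four links of the `(μ,ν)`-plaquette at `x`. [folklore] -/
def plaqLinks (x : Site d L) (μ ν : Fin d) : Finset (Edge d L) :=
  {(x, μ), (x.shift μ, ν), (x.shift ν, μ), (x, ν)}

/-- The plane collar lies in the all-plaquette collar of `Scaling/FluxSectorCollar.lean`. [folklore] -/
theorem planeCollar_subset_collar (x₀ : Site d L) (μ ν : Fin d) (s : ℝ) :
    planeCollar x₀ μ ν s ⊆ collar μ ν s := fun _ ⟨p, hp⟩ => ⟨planeSite x₀ μ ν p, hp⟩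

/-- Monotonicity of the plane collar in its width. [folklore] -/
theorem planeCollar_mono (x₀ : Site d L) (μ ν : Fin d) {s s' : ℝ} (h : s ≤ s') :
    planeCollar x₀ μ ν s ⊆ planeCollar x₀ μ ν s' := fun _ ⟨p, hp⟩ => ⟨p, hp.trans h⟩

/-- `1 - Re u = ‖1 - u‖²/2` on the unit circle. [folklore] -/
theorem circle_one_sub_re_eq (u : Circle) : 1 - (u : ℂ).re = ‖(1 : ℂ) - u‖ ^ 2 / 2 := by
  have h1 : Complex.normSq (u : ℂ) = 1 := Circle.normSq_coe u
  rw [Complex.normSq_apply] at h1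
  rw [Complex.sq_norm, Complex.normSq_apply, Complex.sub_re, Complex.sub_im, Complex.one_re,
    Complex.one_im]
  linear_combination (-(1 : ℝ) / 2) * h1

/-- The patch action is non-negative. [folklore] -/
theorem patchAction_nonneg (x₀ : Site d L) (μ ν : Fin d) (P : Finset (ZMod L × ZMod L))
    (U : GaugeConfig d L Circle) : 0 ≤ patchAction x₀ μ ν P U :=
  Finset.sum_nonneg fun p _ => by rw [circle_one_sub_re_eq]; positivity

/-- `S_P ≤ 2·#P`. [folklore] -/
theorem patchAction_le (x₀ : Site d L) (μ ν : Fin d) (P : Finset (ZMod L × ZMod L))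
    (U : GaugeConfig d L Circle) : patchAction x₀ μ ν P U ≤ 2 * P.card := by
  unfold patchAction
  calc ∑ p ∈ P, (1 - (((plaquetteHolonomy U (planeSite x₀ μ ν p) μ ν : Circle) : ℂ)).re)
      ≤ ∑ p ∈ P, (2 : ℝ) := Finset.sum_le_sum fun p _ => by
        have h := Complex.abs_re_le_norm ((plaquetteHolonomy U (planeSite x₀ μ ν p) μ ν : Circle) : ℂ)
        rw [Circle.norm_coe] at h
        linarith [(abs_le.mp h).1]
    _ = 2 * P.card := by rw [Finset.sum_const, nsmul_eq_mul, mul_comm]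

/-- Links agreeing on the four links of a plaquette give the same plaquette. [folklore] -/
theorem plaquetteHolonomy_eq_of_eqOn {U U' : GaugeConfig d L Circle} {x : Site d L} {μ ν : Fin d}
    (h : ∀ e ∈ plaqLinks x μ ν, U e = U' e) :
    plaquetteHolonomy U x μ ν = plaquetteHolonomy U' x μ ν := by
  unfold plaquetteHolonomy
  rw [h (x, μ) (by simp [plaqLinks]), h (x.shift μ, ν) (by simp [plaqLinks]),
    h (x.shift ν, μ) (by simp [plaqLinks]), h (x, ν) (by simp [plaqLinks])]

/-- LINK PATCHES ⇒ PLAQUETTE PATCHES: if two configurations agree off a set of links `Λ`, their plane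
plaquettes agree off any set `P` of plane positions containing every position whose plaquette touches
`Λ`. [folklore] -/
theorem plaquette_eq_off_patch_of_links {x₀ : Site d L} {μ ν : Fin d} {Λ : Finset (Edge d L)}
    {P : Finset (ZMod L × ZMod L)}
    (hP : ∀ p, (∃ e ∈ plaqLinks (planeSite x₀ μ ν p) μ ν, e ∈ Λ) → p ∈ P)
    {U U' : GaugeConfig d L Circle} (hΛ : ∀ e ∉ Λ, U e = U' e) :
    ∀ p ∉ P, plaquetteHolonomy U (planeSite x₀ μ ν p) μ ν =
      plaquetteHolonomy U' (planeSite x₀ μ ν p) μ ν := by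
  intro p hp
  refine plaquetteHolonomy_eq_of_eqOn fun e he => ?_
  by_cases heΛ : e ∈ Λ
  · exact absurd (hP p ⟨e, he, heΛ⟩) hp
  · exact hΛ e heΛ

variable [NeZero L]

/-- The plane flux as a sum over plane positions. [folklore] -/
theorem magneticFlux_eq_sum_plane (U : GaugeConfig d L Circle) (x₀ : Site d L) (μ ν : Fin d) :
    magneticFlux U x₀ μ ν = ∑ p : ZMod L × ZMod L, abelianFieldTensor U (planeSite x₀ μ ν p) μ ν := by
  unfold magneticFlux planeSite
  exact (Fintype.sum_prod_type' fun s t =>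
    abelianFieldTensor U (x₀ + Pi.single μ s + Pi.single ν t) μ ν).symm

/-! ## §2. Local patches: a charge change costs patch action `≥ 2/#P` -/

omit [NeZero L] in
/-- Chord bound, squared: `(2/π²)·F_p² ≤ 1 - Re u_p`. [folklore] -/
theorem sq_abelianFieldTensor_le (U : GaugeConfig d L Circle) (x : Site d L) (μ ν : Fin d) :
    2 / π ^ 2 * abelianFieldTensor U x μ ν ^ 2 ≤
      1 - (((plaquetteHolonomy U x μ ν : Circle) : ℂ)).re := by
  have h := abs_abelianFieldTensor_le U x μ ν
  have hsq : abelianFieldTensor U x μ ν ^ 2 ≤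
      (π / 2 * ‖(1 : ℂ) - (plaquetteHolonomy U x μ ν : Circle)‖) ^ 2 := by
    rw [← sq_abs]; exact pow_le_pow_left₀ (abs_nonneg _) h 2
  have hπ : π ≠ 0 := Real.pi_ne_zero
  rw [circle_one_sub_re_eq]
  calc 2 / π ^ 2 * abelianFieldTensor U x μ ν ^ 2
      ≤ 2 / π ^ 2 * (π / 2 * ‖(1 : ℂ) - (plaquetteHolonomy U x μ ν : Circle)‖) ^ 2 :=
        mul_le_mul_of_nonneg_left hsq (by positivity)
    _ = ‖(1 : ℂ) - (plaquetteHolonomy U x μ ν : Circle)‖ ^ 2 / 2 := by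
        field_simp

/-- The flux difference of two configurations whose plane plaquettes agree off `P` localises on `P`.
[folklore] -/
theorem magneticFlux_sub_eq_sum_patch {U U' : GaugeConfig d L Circle} {x₀ : Site d L} {μ ν : Fin d}
    {P : Finset (ZMod L × ZMod L)}
    (h : ∀ p ∉ P, plaquetteHolonomy U (planeSite x₀ μ ν p) μ ν =
      plaquetteHolonomy U' (planeSite x₀ μ ν p) μ ν) :
    magneticFlux U x₀ μ ν - magneticFlux U' x₀ μ ν =
      ∑ p ∈ P, (abelianFieldTensor U (planeSite x₀ μ ν p) μ ν -
        abelianFieldTensor U' (planeSite x₀ μ ν p) μ ν) := by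
  rw [magneticFlux_eq_sum_plane, magneticFlux_eq_sum_plane, ← Finset.sum_sub_distrib]
  symm
  refine Finset.sum_subset (Finset.subset_univ P) fun p _ hp => ?_
  simp only [abelianFieldTensor, h p hp, sub_self]

/-- If the charge changes across a `P`-local move, the patch field strengths of one of the two
configurations have `Σ_{p∈P} |F_p| ≥ π`. [folklore] -/
theorem pi_le_sum_abs_or_of_topCharge_ne (x₀ : Site d L) (μ ν : Fin d) {U U' : GaugeConfig d L Circle}
    {P : Finset (ZMod L × ZMod L)}
    (h : ∀ p ∉ P, plaquetteHolonomy U (planeSite x₀ μ ν p) μ ν =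
      plaquetteHolonomy U' (planeSite x₀ μ ν p) μ ν)
    (hQ : topCharge x₀ μ ν U ≠ topCharge x₀ μ ν U') :
    π ≤ ∑ p ∈ P, |abelianFieldTensor U (planeSite x₀ μ ν p) μ ν| ∨
      π ≤ ∑ p ∈ P, |abelianFieldTensor U' (planeSite x₀ μ ν p) μ ν| := by
  obtain ⟨n, hn⟩ := exists_int_magneticFlux_eq U x₀ μ ν
  obtain ⟨n', hn'⟩ := exists_int_magneticFlux_eq U' x₀ μ ν
  have hne : n ≠ n' := by
    intro he
    apply hQ
    unfold topCharge
    rw [hn, hn', he]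
  have h1 : (1 : ℝ) ≤ |(n : ℝ) - n'| := by
    have : (1 : ℤ) ≤ |n - n'| := Int.one_le_abs (sub_ne_zero.mpr hne)
    exact_mod_cast this
  have h2 : 2 * π ≤ |magneticFlux U x₀ μ ν - magneticFlux U' x₀ μ ν| := by
    rw [hn, hn', ← mul_sub, abs_mul, abs_of_pos (by positivity : (0 : ℝ) < 2 * π)]
    nlinarith [Real.pi_pos, h1]
  rw [magneticFlux_sub_eq_sum_patch h] at h2
  have h3 : |∑ p ∈ P, (abelianFieldTensor U (planeSite x₀ μ ν p) μ ν -
        abelianFieldTensor U' (planeSite x₀ μ ν p) μ ν)| ≤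
      ∑ p ∈ P, |abelianFieldTensor U (planeSite x₀ μ ν p) μ ν| +
        ∑ p ∈ P, |abelianFieldTensor U' (planeSite x₀ μ ν p) μ ν| := by
    refine (Finset.abs_sum_le_sum_abs _ _).trans ?_
    rw [← Finset.sum_add_distrib]
    exact Finset.sum_le_sum fun p _ => abs_sub _ _
  by_contra hcon
  push Not at hcon
  linarith [hcon.1, hcon.2]

omit [NeZero L] in
/-- `Σ_{p∈P} |F_p| ≥ π` forces patch action `S_P ≥ 2/#P` (Cauchy–Schwarz and the chord bound).
[folklore] -/
theorem patchAction_ge_of_pi_le_sum_abs (x₀ : Site d L) (μ ν : Fin d) (P : Finset (ZMod L × ZMod L))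
    (U : GaugeConfig d L Circle)
    (hπ : π ≤ ∑ p ∈ P, |abelianFieldTensor U (planeSite x₀ μ ν p) μ ν|) :
    2 / (P.card : ℝ) ≤ patchAction x₀ μ ν P U := by
  rcases Nat.eq_zero_or_pos P.card with h0 | hpos
  · rw [h0, Nat.cast_zero, div_zero]; exact patchAction_nonneg _ _ _ _ _
  have hm : (0 : ℝ) < P.card := by exact_mod_cast hpos
  have hCS := sq_sum_le_card_mul_sum_sq (s := P)
    (f := fun p => |abelianFieldTensor U (planeSite x₀ μ ν p) μ ν|)
  simp only [sq_abs] at hCS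
  have hπ2 : π ^ 2 ≤ (∑ p ∈ P, |abelianFieldTensor U (planeSite x₀ μ ν p) μ ν|) ^ 2 :=
    pow_le_pow_left₀ Real.pi_pos.le hπ 2
  have hterm : ∑ p ∈ P, 2 / π ^ 2 * abelianFieldTensor U (planeSite x₀ μ ν p) μ ν ^ 2 ≤
      patchAction x₀ μ ν P U :=
    Finset.sum_le_sum fun p _ => sq_abelianFieldTensor_le U _ μ ν
  rw [← Finset.mul_sum] at hterm
  have hπ0 : (0 : ℝ) < π ^ 2 := by positivity
  calc 2 / (P.card : ℝ) = 2 / π ^ 2 * (π ^ 2 / P.card) := by field_simp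
    _ ≤ 2 / π ^ 2 * ∑ p ∈ P, abelianFieldTensor U (planeSite x₀ μ ν p) μ ν ^ 2 := by
        refine mul_le_mul_of_nonneg_left ?_ (by positivity)
        rw [div_le_iff₀ hm]
        calc π ^ 2 ≤ _ := hπ2
          _ ≤ _ := hCS
          _ = _ := mul_comm _ _
    _ ≤ patchAction x₀ μ ν P U := hterm

/-- **Patch barrier.**  If two configurations have the same plane plaquettes off a patch `P` and
different charges, one of them has patch action `S_P ≥ 2/#P`. [folklore] -/
theorem patchAction_ge_or_of_topCharge_ne (x₀ : Site d L) (μ ν : Fin d) {U U' : GaugeConfig d L Circle}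
    {P : Finset (ZMod L × ZMod L)}
    (h : ∀ p ∉ P, plaquetteHolonomy U (planeSite x₀ μ ν p) μ ν =
      plaquetteHolonomy U' (planeSite x₀ μ ν p) μ ν)
    (hQ : topCharge x₀ μ ν U ≠ topCharge x₀ μ ν U') :
    2 / (P.card : ℝ) ≤ patchAction x₀ μ ν P U ∨ 2 / (P.card : ℝ) ≤ patchAction x₀ μ ν P U' :=
  (pi_le_sum_abs_or_of_topCharge_ne x₀ μ ν h hQ).imp (patchAction_ge_of_pi_le_sum_abs x₀ μ ν P U)
    (patchAction_ge_of_pi_le_sum_abs x₀ μ ν P U')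

/-- Contrapositive: a `P`-local move between two configurations of patch action `< 2/#P` does not
change the charge; in particular a non-empty patch is needed at all. [folklore] -/
theorem topCharge_eq_of_patchAction_lt (x₀ : Site d L) (μ ν : Fin d) {U U' : GaugeConfig d L Circle}
    {P : Finset (ZMod L × ZMod L)}
    (h : ∀ p ∉ P, plaquetteHolonomy U (planeSite x₀ μ ν p) μ ν =
      plaquetteHolonomy U' (planeSite x₀ μ ν p) μ ν)
    (hU : patchAction x₀ μ ν P U < 2 / (P.card : ℝ)) (hU' : patchAction x₀ μ ν P U' < 2 / (P.card : ℝ)) :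
    topCharge x₀ μ ν U = topCharge x₀ μ ν U' := by
  by_contra hQ
  rcases patchAction_ge_or_of_topCharge_ne x₀ μ ν h hQ with h1 | h1
  · exact absurd h1 (not_le.mpr hU)
  · exact absurd h1 (not_le.mpr hU')

/-! ### §2′. The sharp patch constant `#P·(1 - cos(π/#P))` (`Scaling/CosineBudget.lean`) -/

omit [NeZero L] in
/-- `1 - Re u_p = 1 - cos F_p`. [folklore] -/
theorem one_sub_re_plaquette_eq (U : GaugeConfig d L Circle) (x : Site d L) (μ ν : Fin d) :
    1 - (((plaquetteHolonomy U x μ ν : Circle) : ℂ)).re = 1 - Real.cos (abelianFieldTensor U x μ ν) := by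
  have h := Complex.norm_mul_cos_arg ((plaquetteHolonomy U x μ ν : Circle) : ℂ)
  rw [Circle.norm_coe, one_mul] at h
  rw [abelianFieldTensor, h]

omit [NeZero L] in
/-- The patch action as a sum of `1 - cos F_p`. [folklore] -/
theorem patchAction_eq_sum_one_sub_cos (x₀ : Site d L) (μ ν : Fin d) (P : Finset (ZMod L × ZMod L))
    (U : GaugeConfig d L Circle) :
    patchAction x₀ μ ν P U = ∑ p ∈ P, (1 - Real.cos (abelianFieldTensor U (planeSite x₀ μ ν p) μ ν)) :=
  Finset.sum_congr rfl fun p _ => one_sub_re_plaquette_eq U (planeSite x₀ μ ν p) μ ν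

omit [NeZero L] in
/-- **Sharp patch bound.**  `Σ_{p∈P} |F_p| ≥ π` forces `S_P ≥ #P·(1 - cos(π/#P))` (`= 2` for `#P ≤ 2`,
`∼ π²/(2·#P)` for large patches; attained at `F_p = π/#P`). [folklore] -/
theorem patchAction_ge_sharp_of_pi_le_sum_abs (x₀ : Site d L) (μ ν : Fin d)
    {P : Finset (ZMod L × ZMod L)} (hP : P.Nonempty) (U : GaugeConfig d L Circle)
    (hπ : π ≤ ∑ p ∈ P, |abelianFieldTensor U (planeSite x₀ μ ν p) μ ν|) :
    (P.card : ℝ) * (1 - Real.cos (π / P.card)) ≤ patchAction x₀ μ ν P U := by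
  rw [patchAction_eq_sum_one_sub_cos]
  exact Theory2.Trig.card_mul_one_sub_cos_le_sum P _ hP (fun p _ => abs_abelianFieldTensor_le_pi U _ μ ν) hπ

/-- **Sharp patch barrier.**  If two configurations have the same plane plaquettes off a non-empty
patch `P` and different charges, one of them has `S_P ≥ #P·(1 - cos(π/#P))`; for a single-link update
in `d = 2` (`#P = 2`) the threshold is `S_P ≥ 2`, i.e. Wilson weight `≤ e^{-2β}` relative to the
patch maximum. [folklore] -/
theorem patchAction_ge_sharp_or_of_topCharge_ne (x₀ : Site d L) (μ ν : Fin d)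
    {U U' : GaugeConfig d L Circle} {P : Finset (ZMod L × ZMod L)} (hP : P.Nonempty)
    (h : ∀ p ∉ P, plaquetteHolonomy U (planeSite x₀ μ ν p) μ ν =
      plaquetteHolonomy U' (planeSite x₀ μ ν p) μ ν)
    (hQ : topCharge x₀ μ ν U ≠ topCharge x₀ μ ν U') :
    (P.card : ℝ) * (1 - Real.cos (π / P.card)) ≤ patchAction x₀ μ ν P U ∨
      (P.card : ℝ) * (1 - Real.cos (π / P.card)) ≤ patchAction x₀ μ ν P U' :=
  (pi_le_sum_abs_or_of_topCharge_ne x₀ μ ν h hQ).imp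
    (patchAction_ge_sharp_of_pi_le_sum_abs x₀ μ ν hP U)
    (patchAction_ge_sharp_of_pi_le_sum_abs x₀ μ ν hP U')

/-- With an EMPTY patch (all plane plaquettes unchanged) the charge cannot change. [folklore] -/
theorem topCharge_eq_of_plaquette_eq (x₀ : Site d L) (μ ν : Fin d) {U U' : GaugeConfig d L Circle}
    (h : ∀ p : ZMod L × ZMod L, plaquetteHolonomy U (planeSite x₀ μ ν p) μ ν =
      plaquetteHolonomy U' (planeSite x₀ μ ν p) μ ν) :
    topCharge x₀ μ ν U = topCharge x₀ μ ν U' := by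
  by_contra hQ
  have h' := pi_le_sum_abs_or_of_topCharge_ne x₀ μ ν (P := ∅) (fun p _ => h p) hQ
  simp only [Finset.sum_empty] at h'
  rcases h' with h' | h' <;> linarith [Real.pi_pos]

end Summit.Ventures.LatticeQCDFlow.Theory2.Lattice.Flux
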